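import Summits.Ventures.PercRepro.C026C028SeriesProbe
import Summits.Ventures.PercRepro.C026C028Series
import Summits.Ventures.PercRepro.C026C028SureReduction
import Summits.Ventures.PercRepro.C026C028DeleteEdge

/-!
# A probe attached by two edges to one sure cluster (p6, gen 15; the contracted minor of the K₃-hub)

If the probe `c` carries exactly two edges that are not surely closed, `f₁ = {c, x₁}` and
`f₂ = {c, x₂}`, with `x₁` and `x₂` surely joined, then `c` reaches the marks iff one of `f₁`, `f₂` is
open: the rows `abc`, `ac|b`, `bc|a` at `c` are `q = 1 − (1 − p f₁)(1 − p f₂)` times the rows at `x₁` on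
`p[f₁:=0][f₂:=0]`, `P(a ↔ b)` is unchanged (`rows_of_twoEdgeProbe`), and C-028(c) at the probe `x₁`
on that minor gives C-028(c) at `c` (`C028At_of_twoEdgeProbe`).  This is the contracted minor
`S_{r(2−r)}(B ⊙ B)` of THEOREM T3: two parallel `c`-edges into the merged super-vertex act as one
edge of weight `r(2 − r)`.
-/

namespace PercRepro

namespace MultiGraph

variable {V E : Type*} (G : MultiGraph V E) [Fintype E] [DecidableEq E]

/-- The rows at a probe with two edges into one sure cluster. -/
theorem rows_of_twoEdgeProbe {p : E → ℝ} (hp : IsProb p) {f₁ f₂ : E} (hne : f₁ ≠ f₂)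
    (hf₁ : p f₁ ≠ 1) (hf₂ : p f₂ ≠ 1) {c x₁ x₂ : V}
    (h₁ : (G.fst f₁ = c ∧ G.snd f₁ = x₁) ∨ (G.fst f₁ = x₁ ∧ G.snd f₁ = c))
    (h₂ : (G.fst f₂ = c ∧ G.snd f₂ = x₂) ∨ (G.fst f₂ = x₂ ∧ G.snd f₂ = c))
    (hx : G.SureConn p x₁ x₂)
    (hpend : ∀ e', e' ≠ f₁ → e' ≠ f₂ → (G.fst e' = c ∨ G.snd e' = c) → p e' = 0)
    {a b : V} (ha : a ≠ c) (hb : b ≠ c) (hx₁ : x₁ ≠ c) (s : Fin 5) (hs : s = 0 ∨ s = 2 ∨ s = 3) :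
    G.law3 p a b c s =
      (1 - (1 - p f₁) * (1 - p f₂)) *
        G.law3 (Function.update (Function.update p f₁ 0) f₂ 0) a b x₁ s := by
  -- the two deletion minors and the pendant structure of `c` in them
  have hpendF₂ : ∀ e', e' ≠ f₁ → (G.fst e' = c ∨ G.snd e' = c) → Function.update p f₂ 0 e' = 0 := by
    intro e' he' hc'
    by_cases h : e' = f₂
    · subst h; simp
    · rw [Function.update_of_ne h]; exact hpend e' he' h hc'
  have hpendF₁ : ∀ e', e' ≠ f₂ → (G.fst e' = c ∨ G.snd e' = c) → Function.update p f₁ 0 e' = 0 := by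
    intro e' he' hc'
    by_cases h : e' = f₁
    · subst h; simp
    · rw [Function.update_of_ne h]; exact hpend e' h he' hc'
  have hfc₁ : G.fst f₁ = c ∨ G.snd f₁ = c := by
    rcases h₁ with ⟨h, _⟩ | ⟨_, h⟩
    · exact Or.inl h
    · exact Or.inr h
  have hfc₂ : G.fst f₂ = c ∨ G.snd f₂ = c := by
    rcases h₂ with ⟨h, _⟩ | ⟨_, h⟩
    · exact Or.inl h
    · exact Or.inr h
  have hp₁ : IsProb (Function.update p f₁ 1) := hp.update f₁ ⟨zero_le_one, le_rfl⟩
  have hp₀ : IsProb (Function.update p f₁ 0) := hp.update f₁ ⟨le_rfl, zero_le_one⟩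
  have hp₂₀ : IsProb (Function.update p f₂ 0) := hp.update f₂ ⟨le_rfl, zero_le_one⟩
  -- (i) `f₁` open: the probe transfers to `x₁`, then `f₂` (inside the sure cluster) is irrelevant
  have hT₁ : G.law3 (Function.update p f₁ 1) a b c s =
      G.law3 (Function.update (Function.update p f₁ 0) f₂ 0) a b x₁ s := by
    have hcx₁ : G.SureConn (Function.update p f₁ 1) c x₁ :=
      G.sureConn_of_sure_edge (by simp) h₁
    rw [G.law3_eq_of_sureConn_probe hp₁ hcx₁ a b s]
    -- `f₂` joins `c` and `x₂`, both in the sure cluster of `x₁`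
    have hxy : G.SureConn (Function.update p f₁ 1) (G.fst f₂) (G.snd f₂) := by
      have hcx₂ : G.SureConn (Function.update p f₁ 1) c x₂ :=
        Conn.trans (show G.Conn (sureConfig (Function.update p f₁ 1)) c x₁ from hcx₁)
          (G.sureConn_update_one_of_sureConn f₁ hx)
      rcases h₂ with ⟨e1, e2⟩ | ⟨e1, e2⟩
      · rw [e1, e2]; exact hcx₂
      · rw [e1, e2]; exact Conn.symm hcx₂
    have hf₂' : Function.update p f₁ 1 f₂ ≠ 1 := by rw [Function.update_of_ne hne.symm]; exact hf₂
    have hsplit := G.law3_split_edge (Function.update p f₁ 1) f₂ a b x₁ s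
    rw [G.law3_update_one_eq_update_zero_of_sureConn_endpoints hp₁ hf₂' hxy a b x₁ s] at hsplit
    rw [hsplit]
    -- now `f₁` is pendant at `c` for the marks `a, b, x₁` once `f₂` is closed
    have e₁ : Function.update (Function.update p f₁ 1) f₂ 0 =
        Function.update (Function.update p f₂ 0) f₁ 1 := Function.update_comm hne _ _ _
    have e₀ : Function.update (Function.update p f₁ 0) f₂ 0 =
        Function.update (Function.update p f₂ 0) f₁ 0 := Function.update_comm hne _ _ _
    rw [e₁, e₀, G.law3_update_one_eq_update_zero_of_pendant hp₂₀ hfc₁ hpendF₂ ha hb hx₁ s]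
    ring
  -- (ii) `f₁` closed, `f₂` open: the probe transfers to `x₂`, hence to `x₁`, then `f₂` is pendant
  have hT₂ : G.law3 (Function.update (Function.update p f₁ 0) f₂ 1) a b c s =
      G.law3 (Function.update (Function.update p f₁ 0) f₂ 0) a b x₁ s := by
    have hp₀₁ : IsProb (Function.update (Function.update p f₁ 0) f₂ 1) :=
      hp₀.update f₂ ⟨zero_le_one, le_rfl⟩
    have hcx₂ : G.SureConn (Function.update (Function.update p f₁ 0) f₂ 1) c x₂ :=
      G.sureConn_of_sure_edge (by simp) h₂
    have hx' : G.SureConn (Function.update (Function.update p f₁ 0) f₂ 1) x₂ x₁ :=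
      G.sureConn_update_one_of_sureConn f₂
        (Conn.symm (show G.Conn (sureConfig (Function.update p f₁ 0)) x₁ x₂ from
          (G.sureConn_update_zero_iff hf₁ x₁ x₂).2 hx))
    have hcx₁ : G.SureConn (Function.update (Function.update p f₁ 0) f₂ 1) c x₁ :=
      Conn.trans (show G.Conn (sureConfig (Function.update (Function.update p f₁ 0) f₂ 1)) c x₂
        from hcx₂) hx'
    rw [G.law3_eq_of_sureConn_probe hp₀₁ hcx₁ a b s]
    exact G.law3_update_one_eq_update_zero_of_pendant hp₀ hfc₂ hpendF₁ ha hb hx₁ s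
  -- (iii) both closed: the probe is isolated, the rows `abc`, `ac|b`, `bc|a` vanish
  have hT₀ : G.law3 (Function.update (Function.update p f₁ 0) f₂ 0) a b c s = 0 := by
    have hp₀₀ : IsProb (Function.update (Function.update p f₁ 0) f₂ 0) :=
      hp₀.update f₂ ⟨le_rfl, zero_le_one⟩
    -- `c` reaches no mark: every edge at `c` is surely closed
    have hB : prob (Function.update (Function.update p f₁ 0) f₂ 0)
        (G.connEvent c a ∪ G.connEvent c b) = 0 := by
      have hE : prob (Function.update (Function.update p f₁ 0) f₂ 0)
          (G.connEvent c a ∪ G.connEvent c b) =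
          prob (Function.update (Function.update p f₁ 0) f₂ 0) ∅ := by
        refine prob_eq_of_eqOn_pos hp₀₀ fun ω hω => ?_
        simp only [Set.mem_union, mem_connEvent, Set.mem_empty_iff_false, iff_false, not_or]
        have hclosed : ∀ e', (G.fst e' = c ∨ G.snd e' = c) → ω e' = false := by
          intro e' hc'
          by_cases h1 : e' = f₁
          · rw [h1]
            exact eq_false_of_weight_pos hω (by rw [Function.update_of_ne hne]; simp)
          by_cases h2 : e' = f₂
          · rw [h2]
            exact eq_false_of_weight_pos hω (by simp)
          · refine eq_false_of_weight_pos hω ?_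
            rw [Function.update_of_ne h2, Function.update_of_ne h1]
            exact hpend e' h1 h2 hc'
        exact ⟨fun h => ha (G.eq_of_conn_of_closed_at hclosed h),
          fun h => hb (G.eq_of_conn_of_closed_at hclosed h)⟩
      rw [hE, prob_empty]
    have hsum := G.law3_zero_add_two_add_three (Function.update (Function.update p f₁ 0) f₂ 0) a b c
    rw [hB] at hsum
    have h0 := prob_nonneg hp₀₀ (G.partitionEvent ![a, b, c] ![0, 0, 0])
    have h2 := prob_nonneg hp₀₀ (G.partitionEvent ![a, b, c] ![0, 1, 0])
    have h3 := prob_nonneg hp₀₀ (G.partitionEvent ![a, b, c] ![0, 1, 1])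
    rw [← law3_zero] at h0
    rw [← law3_two] at h2
    rw [← law3_three] at h3
    rcases hs with rfl | rfl | rfl <;> linarith
  -- assemble with the two splits
  have hS₁ := G.law3_split_edge p f₁ a b c s
  have hS₂ := G.law3_split_edge (Function.update p f₁ 0) f₂ a b c s
  rw [Function.update_of_ne hne.symm] at hS₂
  rw [hS₁, hS₂, hT₁, hT₂, hT₀]
  ring

/-- `P(a ↔ b)` does not see the two probe edges. -/
theorem prob_connEvent_twoEdgeProbe {p : E → ℝ} (hp : IsProb p) {f₁ f₂ : E} (hne : f₁ ≠ f₂)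
    (hf₁ : p f₁ ≠ 1) (hf₂ : p f₂ ≠ 1) {c x₁ x₂ : V}
    (h₁ : (G.fst f₁ = c ∧ G.snd f₁ = x₁) ∨ (G.fst f₁ = x₁ ∧ G.snd f₁ = c))
    (h₂ : (G.fst f₂ = c ∧ G.snd f₂ = x₂) ∨ (G.fst f₂ = x₂ ∧ G.snd f₂ = c))
    (hx : G.SureConn p x₁ x₂)
    (hpend : ∀ e', e' ≠ f₁ → e' ≠ f₂ → (G.fst e' = c ∨ G.snd e' = c) → p e' = 0)
    {a b : V} (ha : a ≠ c) (hb : b ≠ c) (hx₁ : x₁ ≠ c) :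
    G.law3 p a b c 0 + G.law3 p a b c 1 =
      G.law3 (Function.update (Function.update p f₁ 0) f₂ 0) a b x₁ 0 +
        G.law3 (Function.update (Function.update p f₁ 0) f₂ 0) a b x₁ 1 := by
  have hpendF₂ : ∀ e', e' ≠ f₁ → (G.fst e' = c ∨ G.snd e' = c) → Function.update p f₂ 0 e' = 0 := by
    intro e' he' hc'
    by_cases h : e' = f₂
    · subst h; simp
    · rw [Function.update_of_ne h]; exact hpend e' he' h hc'
  have hpendF₁ : ∀ e', e' ≠ f₂ → (G.fst e' = c ∨ G.snd e' = c) → Function.update p f₁ 0 e' = 0 := by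
    intro e' he' hc'
    by_cases h : e' = f₁
    · subst h; simp
    · rw [Function.update_of_ne h]; exact hpend e' h he' hc'
  have hfc₁ : G.fst f₁ = c ∨ G.snd f₁ = c := by
    rcases h₁ with ⟨h, _⟩ | ⟨_, h⟩
    · exact Or.inl h
    · exact Or.inr h
  have hfc₂ : G.fst f₂ = c ∨ G.snd f₂ = c := by
    rcases h₂ with ⟨h, _⟩ | ⟨_, h⟩
    · exact Or.inl h
    · exact Or.inr h
  have hp₁ : IsProb (Function.update p f₁ 1) := hp.update f₁ ⟨zero_le_one, le_rfl⟩
  have hp₀ : IsProb (Function.update p f₁ 0) := hp.update f₁ ⟨le_rfl, zero_le_one⟩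
  have hp₂₀ : IsProb (Function.update p f₂ 0) := hp.update f₂ ⟨le_rfl, zero_le_one⟩
  -- the rows at the marks `(a, b, x₁)` under the four minors
  have hrow₁ : ∀ s, G.law3 (Function.update p f₁ 1) a b x₁ s =
      G.law3 (Function.update (Function.update p f₁ 0) f₂ 0) a b x₁ s := by
    intro s
    have hcx₁ : G.SureConn (Function.update p f₁ 1) c x₁ := G.sureConn_of_sure_edge (by simp) h₁
    have hxy : G.SureConn (Function.update p f₁ 1) (G.fst f₂) (G.snd f₂) := by
      have hcx₂ : G.SureConn (Function.update p f₁ 1) c x₂ :=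
        Conn.trans (show G.Conn (sureConfig (Function.update p f₁ 1)) c x₁ from hcx₁)
          (G.sureConn_update_one_of_sureConn f₁ hx)
      rcases h₂ with ⟨e1, e2⟩ | ⟨e1, e2⟩
      · rw [e1, e2]; exact hcx₂
      · rw [e1, e2]; exact Conn.symm hcx₂
    have hf₂' : Function.update p f₁ 1 f₂ ≠ 1 := by rw [Function.update_of_ne hne.symm]; exact hf₂
    have hsplit := G.law3_split_edge (Function.update p f₁ 1) f₂ a b x₁ s
    rw [G.law3_update_one_eq_update_zero_of_sureConn_endpoints hp₁ hf₂' hxy a b x₁ s] at hsplit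
    rw [hsplit]
    have e₁ : Function.update (Function.update p f₁ 1) f₂ 0 =
        Function.update (Function.update p f₂ 0) f₁ 1 := Function.update_comm hne _ _ _
    have e₀ : Function.update (Function.update p f₁ 0) f₂ 0 =
        Function.update (Function.update p f₂ 0) f₁ 0 := Function.update_comm hne _ _ _
    rw [e₁, e₀, G.law3_update_one_eq_update_zero_of_pendant hp₂₀ hfc₁ hpendF₂ ha hb hx₁ s]
    ring
  have hrow₂ : ∀ s, G.law3 (Function.update (Function.update p f₁ 0) f₂ 1) a b x₁ s =
      G.law3 (Function.update (Function.update p f₁ 0) f₂ 0) a b x₁ s :=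
    fun s => G.law3_update_one_eq_update_zero_of_pendant hp₀ hfc₂ hpendF₁ ha hb hx₁ s
  -- `P(A)` is the same at every probe, and splits along `f₁`, `f₂`
  have hA : ∀ (p' : E → ℝ), G.law3 p' a b c 0 + G.law3 p' a b c 1 =
      G.law3 p' a b x₁ 0 + G.law3 p' a b x₁ 1 := by
    intro p'; rw [G.law3_zero_add_one, G.law3_zero_add_one]
  rw [hA, G.law3_split_edge p f₁ a b x₁ 0, G.law3_split_edge p f₁ a b x₁ 1,
    G.law3_split_edge (Function.update p f₁ 0) f₂ a b x₁ 0,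
    G.law3_split_edge (Function.update p f₁ 0) f₂ a b x₁ 1, hrow₁ 0, hrow₁ 1, hrow₂ 0, hrow₂ 1]
  ring

/-- **C-028(c) at a probe with two edges into one sure cluster**: C-028(c) at the probe `x₁` on
`p[f₁:=0][f₂:=0]` gives C-028(c) at `c` on `p`. -/
theorem C028At_of_twoEdgeProbe {p : E → ℝ} (hp : IsProb p) {f₁ f₂ : E} (hne : f₁ ≠ f₂)
    (hf₁ : p f₁ ≠ 1) (hf₂ : p f₂ ≠ 1) {c x₁ x₂ : V}
    (h₁ : (G.fst f₁ = c ∧ G.snd f₁ = x₁) ∨ (G.fst f₁ = x₁ ∧ G.snd f₁ = c))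
    (h₂ : (G.fst f₂ = c ∧ G.snd f₂ = x₂) ∨ (G.fst f₂ = x₂ ∧ G.snd f₂ = c))
    (hx : G.SureConn p x₁ x₂)
    (hpend : ∀ e', e' ≠ f₁ → e' ≠ f₂ → (G.fst e' = c ∨ G.snd e' = c) → p e' = 0)
    {a b : V} (ha : a ≠ c) (hb : b ≠ c) (hx₁ : x₁ ≠ c)
    (h0 : G.C028At (Function.update (Function.update p f₁ 0) f₂ 0) a b x₁) : G.C028At p a b c := by
  have r0 := G.rows_of_twoEdgeProbe hp hne hf₁ hf₂ h₁ h₂ hx hpend ha hb hx₁ 0 (Or.inl rfl)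
  have r2 := G.rows_of_twoEdgeProbe hp hne hf₁ hf₂ h₁ h₂ hx hpend ha hb hx₁ 2 (Or.inr (Or.inl rfl))
  have r3 := G.rows_of_twoEdgeProbe hp hne hf₁ hf₂ h₁ h₂ hx hpend ha hb hx₁ 3 (Or.inr (Or.inr rfl))
  have rA := G.prob_connEvent_twoEdgeProbe hp hne hf₁ hf₂ h₁ h₂ hx hpend ha hb hx₁
  set q := 1 - (1 - p f₁) * (1 - p f₂) with hq
  have hq0 : 0 ≤ q := by
    rw [hq]; nlinarith [(hp f₁).1, (hp f₁).2, (hp f₂).1, (hp f₂).2]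
  set p' := Function.update (Function.update p f₁ 0) f₂ 0 with hp'
  have hd : G.c028Cov p a b c = q * G.c028Cov p' a b x₁ := by
    unfold c028Cov
    rw [rA, r0, r2, r3]
    ring
  unfold C028At at h0 ⊢
  rw [hd, r2, r3]
  have hsq : Real.sqrt (q * G.law3 p' a b x₁ 2 * (q * G.law3 p' a b x₁ 3)) =
      q * Real.sqrt (G.law3 p' a b x₁ 2 * G.law3 p' a b x₁ 3) := by
    rw [show q * G.law3 p' a b x₁ 2 * (q * G.law3 p' a b x₁ 3) =
        q ^ 2 * (G.law3 p' a b x₁ 2 * G.law3 p' a b x₁ 3) by ring,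
      Real.sqrt_mul (sq_nonneg _), Real.sqrt_sq hq0]
  rw [hsq]
  exact mul_le_mul_of_nonneg_left h0 hq0

end MultiGraph

end PercRepro
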